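import Summits.BirchSwinnertonDyer.BirchSwinnertonDyer.Theses.KolyvaginRankRigidityAtTwo
import Summits.BirchSwinnertonDyer.BirchSwinnertonDyer.Theorems.KolyvaginRankRigidityAtTwoKolyvaginBoundedDefectAtTwoDepthZero
import Summits.BirchSwinnertonDyer.BirchSwinnertonDyer.Theorems.Rank1ResidualJetRingClassFields
import Summits.BirchSwinnertonDyer.BirchSwinnertonDyer.Theorems.Rank1ResidualJetCoreVertexBridge
import Literature.NumberTheory.EllipticCurves.Jetchev2008.CoreVertices
import Literature.NumberTheory.EllipticCurves.BipartiteToricPeriod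
import Summits.BirchSwinnertonDyer.BirchSwinnertonDyer.Theorems.KolyvaginRoadThreeLevelData
import Literature.NumberTheory.EllipticCurves.HeegnerPointsOfConductorRationalityProofs
import Literature.NumberTheory.EllipticCurves.RingClassGalOverCyclicProofs
import Mathlib.NumberTheory.Padics.PadicNumbers
import HarnessLib

/-!
# LINE 39 (v1.3: transvection Kolyvagin primes; v1.2: critic #601 P1 cure (a) + P3 cites) «signed_bipartite» on crux U1 `KolyvaginBoundedDefectAtTwo` (stmt-BirchSwinnertonDyer-28083)
# — a SIGNED BIPARTITE EULER SYSTEM AT 2: toric periods of mod-`2^M` quaternionic eigenforms raised at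
#   KOLYVAGIN primes (both signs raise there), in Kolyvagin's exponent (bounded-defect) currency
(ideator seat bsd-idea-1 g29; technique card «compactness–contradiction / rigidity»; NOT registered — W-79;
 the line of record on 28083 stays LINE 17 `kolyvagin_swap`.)  No summit / rung / crux is proved by this file.

V1.3 / V1.1 CHANGE (2026-08-31 ~01:45Z, instrument-driven, print-anchored): «TRANSVECTION KOLYVAGIN PRIMES».  At `p = 2`
Zhang's divisibility definition of a Kolyvagin prime (`IsKolyvaginPrime`: inert, `2^M ∣ ℓ+1`, `2^M ∣ a_ℓ`) does NOT pin
`ρ̄(Frob_ℓ) ∈ GL₂(𝔽₂)`: it may be `1` (scalar) or a transvection.  Multiplicity one for the `ℓ`-new definite quaternionic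
module at `𝔪` needs «`ρ̄(Frob_ℓ)` non-scalar» [Ribet–Stein, Lectures on Serre's conjectures, Thm 3.19 + Lemma 3.20 (for
residue characteristic 2: choose `q` with `ρ̄(Frob_q) ~ (1 1; 0 1)`); corpus:book:conradnd-arithmetic-algebraic-geometry p.185],
and the kit instrument (j342286 + j342299) shows the dichotomy at depth: 53a1, `ℓ = 11` (transvection): signed
`𝔪`-eigenfunctional depth `= s_± = v₂(a_ℓ ∓ (ℓ+1)) = 2` (full); `ℓ = 31` (`ρ̄(Frob₃₁) = 1`): mod-2 signed kernel `(ℤ/2)²`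
(multiplicity two) and signed depth `1 < 2`; 503a1 `ℓ = 5` (transvection, a non-Gorenstein-at-2 curve!): depths `(3,2) = (s₊,s₋)`.
Hence: the definite-side stubs ZB3 / ZB1′ / ZB2 now carry the hypothesis `FrobTransvectionAt W ℓ` (exactly one root of the
2-division cubic mod `ℓ`), and the Galois-side window (S1 / RL1) must SUPPLY such primes (Chebotarev with the class of `τ·g`,
`g ≡ (1 1; 0 1) mod 2`; automatic for `Δ_E < 0` where `ρ̄(τ)` is itself a transvection).  Composition re-proved.

THE MOVE.  The Bertolini–Darmon / W. Zhang / C.-H. Kim bipartite machine (classes `κ(n)` at even depth,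
toric PERIODS `λ(n)` at odd depth, reciprocity laws between them) has never been typed at `p = 2` because
(i) BD-admissible primes do not exist at `2` and are vacuous at `3` (`Literature.Barriers…NoAdmissiblePrimesAtThree`,
tree `not_isAdmissiblePrime_two`), and (ii) at the prime `2` «there is an obstruction for lowering the
2-Selmer rank over `K` from one to zero» [Li2015 = C. Li, Harvard thesis 2015 / IMRN 2019 rnx188],
[LeHungLi2016, p. 4: «this strategy would not naively work for ℓ = 2»].  This line replaces admissible
primes by KOLYVAGIN primes `ℓ` (`2^{M+t} ∣ ℓ+1, a_ℓ`): there the level-raising congruence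
`a_ℓ ≡ ±(ℓ+1) (mod 2^M)` holds for BOTH signs, so two raised eigenforms `g_ℓ^±` exist and the sign `ε`
(the `W_ℓ`-eigenvalue, typed through the ramified ideal `𝔔_ℓ` of the definite algebra `B_ℓ`) becomes a
free parameter that is matched to the complex-conjugation sign of the frame's Selmer line; and it replaces
`𝔽₂`-dimension counting (where Li's obstruction lives: signs are invisible mod 2) by Kolyvagin's exponent
currency `2^(M−C)` (U1's own), in which index-2 phenomena (`H ≠ H⁺ ⊕ H⁻` at 2) are bounded defects.

STUBS (2 Galois-side, 3 quaternionic; the composition `KolyvaginBoundedDefectAtTwo_of` is kernel-checked):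
* S1  `stub_signedRankLoweringAtTwo` (M/L, tree-supported: Chebotarev window primes at 2 + global duality at a
      core vertex, Jetchev 2008 §5 / Mazur–Rubin): on a corank-one frame there are a sign `ε` and a bound `B`
      such that for every `M, t` some Kolyvagin prime `ℓ` of index `≥ M+t` has SIGNED ORDINARY SELMER GROUP
      `ORD_ε(M,ℓ) = Sel^{(−ε)} + H_{𝓕(ℓ)}^{(ε)}` of order `≤ 2^B` (tree objects `Jetchev2008.signPart`,
      `Jetchev2008.modifiedSelmerGroup`).
* ZB3 `stub_signedLevelRaisingAtTwo` (L, beyond print for `M ≥ 2`; print anchor `M = 1` WITH PRESCRIBED SIGNS =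
      [LeHungLi2016, Thm 1]): at a Kolyvagin prime of index `≥ M+t` and for either sign `ε` there is a mod-`2^M`
      eigenfunction `φ` on the right-ideal classes of an Eichler order of level `N` in the definite quaternion
      algebra ramified exactly at `ℓ` (and `∞`), with `T_q φ = a_q(E) φ` (`q ∤ Nℓ`), `W_ℓ φ = ε φ`, primitive and
      alone on its eigenline, together with a Gross point of conductor `1` (Kim 2024 App. A vocabulary, Mathlib-only).
* ZB1′ `stub_signedDefiniteRigidityAtTwo` (XL — THE WALL of the line: a rank-ZERO lower bound at 2 for the
      raised form, Skinner–Urban's role in [WZhang2014]; Howard 2006 Thm 3.2.3 / Kim 2024 Thm 4.19 give the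
      shape at `p ≥ 5`): `#ORD_{σε}(M,ℓ) ≤ 2^B` forces the toric period of the sign-`ε` form to have additive
      order `≥ 2^(M−C−B)` (`σ` a universal sign absorbing the `U_ℓ = −W_ℓ` convention).
* ZB2 `stub_signedFirstReciprocityAtTwo` (L, print-port at 2 of the first reciprocity law / Jochnowitz
      congruence [WZhang2014 Thm 4.3/6.5 = BertoliniDarmon2005 Thm 4.2 (second law), Vatsal], exponent form): the toric period's
      order is `≤ 2^C ·` the order of Kolyvagin's class `c_M(1)` of `P(1) = y_K`.
* S3  `stub_offCorankOneResidualAtTwo` (XL, honest residual): U1 itself on the frames with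
      `corank_{ℤ₂} Sel_{2^∞}(E/K) ≠ 1` (Kolyvagin's conjecture at 2 off corank one; parity makes corank 0 empty).
COMPOSITION: corank one ⇒ (S1) `ε, B`, for each `M` a prime `ℓ`; (ZB3) the sign-`σε` datum; (ZB1′) period
`≥ 2^(M−C₁−B)`; (ZB2) `ord c_M(1) ≥ 2^(M−C₁−B−C₂)`; hence `2^(M−m−1)·c_M(1) ≠ 0` with `m = C₁+B+C₂`, which is
U1's witness at depth `r = 0`, conductor `n = 1` (`KolSupp _ 1`, `M(1) = ∞`); else S3.
HONEST LABEL: modulo S1+ZB2+ZB3 the wall ZB1′ restricted to corank one is EQUIVALENT to U1|corank-one (first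
law both ways) — the transfer's teeth are (a) the period side is a finite computation per `(E,K,ℓ,M)` (Brandt
module of `B_ℓ` mod `2^M`: the instrument that refutes ZB1′/ZB2 on a named curve), (b) the rank-0 wall at 2 is
where the summit's by-reduction-type inputs (route ByReductionTypeAtTwo) already live, now for congruent forms.
-/

set_option autoImplicit false
set_option linter.dupNamespace false

noncomputable section

open scoped Classical BigOperators
open WeierstrassCurve Field Literature.NumberTheory.EllipticCurves
  Literature.NumberTheory.EllipticCurves.ModularForms Literature.NumberTheory.GaloisRepresentations
open Summit.BirchSwinnertonDyer.BirchSwinnertonDyer.Theses.KolyvaginRankRigidityAtTwo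

namespace Summit.BirchSwinnertonDyer.BirchSwinnertonDyer.Cruxes.KolyvaginBoundedDefectAtTwo.SignedBipartite

/-! ## Quaternionic vocabulary at `p = 2`, `N⁻ = 1`, `n = ℓ` (Kim 2024 App. A / Thm 4.26 binder block, Mathlib-only) -/

/-- A maximal `ℤ`-order of the quaternion algebra `(a, b)_ℚ`: a finitely generated full `ℤ`-lattice subring,
maximal among such. [cite: Kim2024, §4.2.2 (the Eichler order `R_{N⁺}`)] [cite: Voight2021, §10.1, §23.1] -/
def IsMaximalZOrder {a b : ℚ} (S : Subring (QuaternionAlgebra ℚ a 0 b)) : Prop :=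
  S.toAddSubgroup.FG ∧ (∀ d : QuaternionAlgebra ℚ a 0 b, ∃ m : ℤ, m ≠ 0 ∧ m • d ∈ S) ∧
    ∀ S' : Subring (QuaternionAlgebra ℚ a 0 b), S'.toAddSubgroup.FG → S ≤ S' → S' = S

/-- An Eichler order of level `Nplus`: the intersection of two maximal orders, of index `Nplus` in one of them.
[cite: Kim2024, §4.2.2] [cite: Voight2021, §23.4] -/
def IsEichlerOrder {a b : ℚ} (O : Subring (QuaternionAlgebra ℚ a 0 b)) (Nplus : ℕ) : Prop :=
  ∃ O₁ O₂ : Subring (QuaternionAlgebra ℚ a 0 b), IsMaximalZOrder O₁ ∧ IsMaximalZOrder O₂ ∧ O = O₁ ⊓ O₂ ∧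
    O.toAddSubgroup.relIndex O₁.toAddSubgroup = Nplus

/-- `(a, b)_ℚ` is definite and ramified exactly at the (finite) primes dividing `D`. [cite: Kim2024, §4.2.2 (`B_{nN⁻}`)] -/
def IsDefiniteOfDisc (a b : ℚ) (D : ℕ) : Prop :=
  a < 0 ∧ b < 0 ∧ ∀ (q : ℕ) [Fact q.Prime],
    (∀ x : QuaternionAlgebra ℚ_[q] (a : ℚ_[q]) 0 (b : ℚ_[q]), x ≠ 0 → IsUnit x) ↔ q ∣ D

/-- An invertible right `O`-ideal: a full `ℤ`-lattice `J` with right order exactly `O` and a two-sided inverse.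
(`B̂× / R̂×` as a set of lattices.) [cite: Kim2024, §4.2.2] [cite: Voight2021, §16.5] -/
def IsRightIdeal {a b : ℚ} (O : Subring (QuaternionAlgebra ℚ a 0 b)) (J : Submodule ℤ (QuaternionAlgebra ℚ a 0 b)) :
    Prop :=
  J.FG ∧ (∀ d : QuaternionAlgebra ℚ a 0 b, ∃ m : ℤ, m ≠ 0 ∧ m • d ∈ J) ∧
    (∀ x : QuaternionAlgebra ℚ a 0 b, (∀ y ∈ J, y * x ∈ J) ↔ x ∈ O) ∧
    ∃ J' : Submodule ℤ (QuaternionAlgebra ℚ a 0 b),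
      (∀ x : QuaternionAlgebra ℚ a 0 b, x ∈ J * J' ↔ ∀ y ∈ J, x * y ∈ J) ∧
      (∀ x : QuaternionAlgebra ℚ a 0 b, x ∈ J' * J ↔ x ∈ O)

/-- The `q + 1` Hecke neighbours of `J` for `T_q` (`q ∤ Nℓ`): right-`O`-stable sublattices of index `q²`.
[cite: Kim2024, §4.2.2 (the Hecke algebra `𝕋^{nN⁻}(N⁺)`)] -/
def heckeSet {a b : ℚ} (O : Subring (QuaternionAlgebra ℚ a 0 b)) (q : ℕ) (J : Submodule ℤ (QuaternionAlgebra ℚ a 0 b)) :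
    Set (Submodule ℤ (QuaternionAlgebra ℚ a 0 b)) :=
  {J' | J' ≤ J ∧ J'.toAddSubgroup.relIndex J.toAddSubgroup = q ^ 2 ∧ ∀ y ∈ J', ∀ x ∈ O, y * x ∈ J'}

/-- The two-sided ideal `𝔔_ℓ` of `O` above the RAMIFIED prime `ℓ` (elements of `O` of reduced norm divisible by
`ℓ`; `𝔔_ℓ² = ℓ O`), as a `ℤ`-lattice: right multiplication by it is the involution `W_ℓ` on `B̂×/R̂×` whose
eigenvalue is the SIGN of an `ℓ`-new form — the new lever (both signs occur at a Kolyvagin prime).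
[cite: Voight2021, §13.3 (the unique maximal ideal at a ramified prime), §23.4] [cite: LeHungLi2016, §1 (the sign at `q_i`)] -/
def ramifiedIdeal {a b : ℚ} (O : Subring (QuaternionAlgebra ℚ a 0 b)) (ℓ : ℕ) :
    Submodule ℤ (QuaternionAlgebra ℚ a 0 b) :=
  Submodule.span ℤ {x : QuaternionAlgebra ℚ a 0 b | x ∈ O ∧ ∃ m : ℤ, (x * star x).re = (ℓ : ℚ) * m}

/-- **Signed mod-`2^M` eigenfunction**: `B×`-invariant on the invertible right `O`-ideals, `T_q`-eigenvalue
`a_q(E)` for every prime `q ∤ Nℓ`, and `W_ℓ`-eigenvalue `ε`. [cite: Kim2024, Thm 4.22 (weak level raising) and §4.2.3]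
[cite: LeHungLi2016, Thm 1 (prescribed signs mod 2)] -/
def IsSignedEig (W : WeierstrassCurve ℚ) [W.IsGloballyMinimal] {a b : ℚ} (O : Subring (QuaternionAlgebra ℚ a 0 b)) (M ℓ : ℕ) (ε : ℤ)
    (g : Submodule ℤ (QuaternionAlgebra ℚ a 0 b) → ZMod (2 ^ M)) : Prop :=
  (∀ J : Submodule ℤ (QuaternionAlgebra ℚ a 0 b), IsRightIdeal O J → ∀ β : QuaternionAlgebra ℚ a 0 b, IsUnit β →
      g (J.map (AddMonoidHom.mulLeft β).toIntLinearMap) = g J) ∧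
  (∀ q : ℕ, q.Prime → ¬ q ∣ W.conductorNorm ℤ * ℓ → ∀ J : Submodule ℤ (QuaternionAlgebra ℚ a 0 b), IsRightIdeal O J →
      ∑ᶠ J' ∈ heckeSet O q J, g J' = ((W.frobeniusTrace q : ℤ) : ZMod (2 ^ M)) * g J) ∧
  (∀ J : Submodule ℤ (QuaternionAlgebra ℚ a 0 b), IsRightIdeal O J → g (J * ramifiedIdeal O ℓ) = (ε : ZMod (2 ^ M)) * g J)

/-- **Signed raised newvector mod `2^M`**: a signed eigenfunction that is primitive (takes a unit value) and alone on
its eigenline among the eigenfunctions of the same sign (multiplicity one mod `2^M` — a HYPOTHESIS in Kim's fact, a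
CONCLUSION of ZB3 here). [cite: Kim2024, Thm 4.26 (hypotheses)] -/
def IsSignedNewvector (W : WeierstrassCurve ℚ) [W.IsGloballyMinimal] {a b : ℚ} (O : Subring (QuaternionAlgebra ℚ a 0 b)) (M ℓ : ℕ) (ε : ℤ)
    (φ : Submodule ℤ (QuaternionAlgebra ℚ a 0 b) → ZMod (2 ^ M)) : Prop :=
  IsSignedEig W O M ℓ ε φ ∧ (∃ J : Submodule ℤ (QuaternionAlgebra ℚ a 0 b), IsRightIdeal O J ∧ IsUnit (φ J)) ∧
    ∀ g : Submodule ℤ (QuaternionAlgebra ℚ a 0 b) → ZMod (2 ^ M), IsSignedEig W O M ℓ ε g →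
      ∃ u : ZMod (2 ^ M), ∀ J : Submodule ℤ (QuaternionAlgebra ℚ a 0 b), IsRightIdeal O J → g J = u * φ J

/-- **Gross point of conductor `1`** on `B̂×/R̂×`: an invertible right ideal `I` with an embedding `ψ : K → B`
that is OPTIMAL for `𝒪_K` into the left order of `I`, plus integral representatives of the ideal classes of `K`
(for the `Pic(𝒪_K)`-orbit). [cite: Kim2024, App. A (the Gross point `ς^(0)`)] [cite: Gross1987, §3] -/
def IsGrossPoint {a b : ℚ} (O : Subring (QuaternionAlgebra ℚ a 0 b)) (K : Type) [Field K] [NumberField K]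
    (ψ : K →ₐ[ℚ] QuaternionAlgebra ℚ a 0 b) (I : Submodule ℤ (QuaternionAlgebra ℚ a 0 b))
    (rep : ClassGroup (NumberField.RingOfIntegers K) → nonZeroDivisors (Ideal (NumberField.RingOfIntegers K))) : Prop :=
  IsRightIdeal O I ∧ (∀ x : NumberField.RingOfIntegers K, ∀ y ∈ I, ψ (x : K) * y ∈ I) ∧
    (∀ x : K, (∀ y ∈ I, ψ x * y ∈ I) → ∃ z : NumberField.RingOfIntegers K, (z : K) = x) ∧
    ∀ 𝔞 : ClassGroup (NumberField.RingOfIntegers K), ClassGroup.mk0 (rep 𝔞) = 𝔞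

/-- **The toric period** `Σ_{[𝔞] ∈ Pic(𝒪_K)} φ(ψ(𝔞) · I) ∈ ℤ/2^M` of `φ` against the Gross point `(ψ, I)`.
[cite: Kim2024, §4.2.3 (`λ^bip_n`)] [cite: BertoliniDarmon2005, §1.1 (the special value `ℒ_g`)] -/
def toricPeriod {a b : ℚ} {K : Type} [Field K] [NumberField K] {M : ℕ}
    (φ : Submodule ℤ (QuaternionAlgebra ℚ a 0 b) → ZMod (2 ^ M)) (ψ : K →ₐ[ℚ] QuaternionAlgebra ℚ a 0 b)
    (I : Submodule ℤ (QuaternionAlgebra ℚ a 0 b))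
    (rep : ClassGroup (NumberField.RingOfIntegers K) → nonZeroDivisors (Ideal (NumberField.RingOfIntegers K))) :
    ZMod (2 ^ M) :=
  ∑ 𝔞 : ClassGroup (NumberField.RingOfIntegers K),
    φ (Submodule.span ℤ ((fun x : NumberField.RingOfIntegers K => ψ (x : K)) ''
      ((rep 𝔞 : nonZeroDivisors (Ideal (NumberField.RingOfIntegers K))) : Ideal (NumberField.RingOfIntegers K))) * I)

/-- **A signed raised datum at `(M, ℓ, ε)`**: definite algebra of discriminant `ℓ`, Eichler order of level `N`,
signed newvector, Gross point of conductor `1`. -/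
def IsSignedDatum (W : WeierstrassCurve ℚ) [W.IsGloballyMinimal] (K : Type) [Field K] [NumberField K] (M ℓ : ℕ) (ε : ℤ) (a b : ℚ)
    (O : Subring (QuaternionAlgebra ℚ a 0 b)) (φ : Submodule ℤ (QuaternionAlgebra ℚ a 0 b) → ZMod (2 ^ M))
    (ψ : K →ₐ[ℚ] QuaternionAlgebra ℚ a 0 b) (I : Submodule ℤ (QuaternionAlgebra ℚ a 0 b))
    (rep : ClassGroup (NumberField.RingOfIntegers K) → nonZeroDivisors (Ideal (NumberField.RingOfIntegers K))) : Prop :=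
  IsDefiniteOfDisc a b ℓ ∧ IsEichlerOrder O (W.conductorNorm ℤ) ∧ IsSignedNewvector W O M ℓ ε φ ∧ IsGrossPoint O K ψ I rep

/-! ## The signed ordinary Selmer group at a Kolyvagin prime (tree objects of Jetchev 2008) -/

/-- **`ORD_ε(M, ℓ) := Sel_{2^M}(E/K)^{(−ε)} + H_{𝓕(ℓ)}(2^M)^{(ε)}`** — the sign-decomposed mod-`2^M` Selmer group
of the sign-`ε` level-raised form at the Kolyvagin prime `ℓ` (`Frob_ℓ = τ`): classes of complex-conjugation
sign `−ε` that are Selmer everywhere, plus classes of sign `ε` that are Selmer off `λ` and TRANSVERSE at `λ`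
(the BD ordinary condition `H¹_ord = H¹_f^{(−ε)} ⊕ H¹_tr^{(ε)}` at `λ ∣ ℓ`, read through the global signs).
[cite: BertoliniDarmon2005, Def. 2.2–2.3 (ordinary condition at admissible primes)] [cite: Jetchev2008, §3.2.2, §3.4.1, §5.2] -/
def signedOrdSel (W : WeierstrassCurve ℚ) (K : Type) [Field K] [NumberField K] (ι : K →+* ℂ)
    [∀ k : ℕ, NumberField (ringClassField K ι k)] (τ : K ≃ₐ[ℚ] K) (M ℓ : ℕ) (ε : ℤ) :
    AddSubgroup (galoisCohomology ((W.baseChange K).torsionGaloisModule ((2 ^ M : ℕ) : ℤ)) 1) :=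
  Jetchev2008.signPart W K τ ((2 ^ M : ℕ) : ℤ) (-ε) (Jetchev2008.modifiedSelmerGroup W K ι ((2 ^ M : ℕ) : ℤ) 1) ⊔
    Jetchev2008.signPart W K τ ((2 ^ M : ℕ) : ℤ) ε (Jetchev2008.modifiedSelmerGroup W K ι ((2 ^ M : ℕ) : ℤ) ℓ)

/-- **Buzzard's multiplicity-one condition at `2`** («`2` does not split completely in `ℚ(E[2])`», i.e.
`ρ̄_{E,2}|_{G_{ℚ₂}} ≠ 1`: `ρ̄` ramified at `2` or `ρ̄(Frob₂)` non-scalar), typed Mathlib-only as: the 2-division cubic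
`4x³ + b₂x² + 2b₄x + b₆` of `W` does NOT have three roots in `ℚ₂` (a root `x₀ ∈ ℚ₂` carries the 2-torsion point
`(x₀, −(a₁x₀ + a₃)/2) ∈ E(ℚ₂)`, so three roots ⟺ `E[2] ⊆ E(ℚ₂)` ⟺ `2` splits completely in `ℚ(E[2])`).  Mod-2
MULTIPLICITY ONE for `𝕋_𝔪` on the definite side holds under it (Buzzard) and FAILS without it (Kilford: `𝕋_𝔪` is
not Gorenstein at the prime conductors `431, 503, 2089`, where `2` splits completely in `ℚ(E[2])` — `431.a1` lies in
U1's frame).  Critic idea-crit-5 #601 price P1, cure (a): this hypothesis is carried by ZB3 / ZB1′ / ZB2 and its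
complement is swallowed by the widened residual S3.
[cite: Kilford2002, Thm 1 (non-Gorenstein at 431, 503, 2089) and §1 (Buzzard: multiplicity one if ρ̄ is ramified at 2
or ρ̄(Frob₂) is non-scalar)] [corpus:doi-10-1006-jnth-2002-2803 p.2–3] [cite: KilfordWiese2008, Thm 1.2 (multiplicity one for k = p = 2: ρ̄ ramified at 2, or unramified
with ρ̄(Frob₂) non-scalar — Mazur L.15.1 / Edixhoven Thm 9.2 / Gross Prop. 12.10 / Buzzard Thm 6.1) and Thm 1.3 (scalar Frob₂ ⇒
multiplicity > 1)] [corpus:paper:arxiv-math_0612317 p.3–4] -/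
def TwoTorsionNonsplitAtTwo (W : WeierstrassCurve ℚ) : Prop :=
  (WeierstrassCurve.twoTorsionPolynomial (W.map (algebraMap ℚ ℚ_[2]))).roots.card ≠ 3

/-- **Transvection Kolyvagin primes** (v1.3 refinement, print-anchored + instrument-driven). `FrobTransvectionAt W ℓ`: the
2-division cubic of the minimal model has EXACTLY ONE root in `ZMod ℓ`, i.e. (for `ℓ ∤ 2Δ`) `ρ̄_{E,2}(Frob_ℓ)` is a transposition in
`S₃ = GL₂(𝔽₂)` — a TRANSVECTION, non-scalar. At `p = 2` Zhang's divisibility definition of a Kolyvagin prime (`IsKolyvaginPrime`: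
inert, `2^M ∣ ℓ+1`, `2^M ∣ a_ℓ`) no longer pins the Frobenius class: `X² − a_ℓX + ℓ ≡ (X − 1)² (mod 2)` allows `ρ̄(Frob_ℓ) = 1`
(scalar) as well as a transvection, and MULTIPLICITY ONE for the `ℓ`-new quaternionic module at `𝔪` needs «`ρ̄(Frob_ℓ)` not a
scalar» [Ribet–Stein, *Lectures on Serre's conjectures* §3.3.11, Thm 3.19 + Lemma 3.20: for residue characteristic 2 choose `q`
with `ρ̄(Frob_q)` conjugate to `(1 1; 0 1)`] [corpus:book:conradnd-arithmetic-algebraic-geometry p.185] (= the `q`-adic twin of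
Buzzard's condition at 2, `TwoTorsionNonsplitAtTwo`). INSTRUMENT (kit j342286/j342299, 53a1): `ℓ = 11` (transvection,
`s_± = v₂(a_ℓ ∓ (ℓ+1)) = 2`): signed 𝔪-eigenfunctional depth `2 = s_±` (full); `ℓ = 31` (`ρ̄(Frob₃₁) = 1`: the cubic
`4x³ − 3x² + 2x + 1` has the three roots `4, 7, 13 mod 31`): mod-2 signed kernel `(ℤ/2)²` = multiplicity TWO and signed depth
`1 < s_± = 2`. So the definite-side stubs are posed at transvection primes only, and the Galois-side window must SUPPLY them
(Chebotarev with the class of `τ·g`, `g ≡ (1 1; 0 1) mod 2`, `τg` of characteristic polynomial `X² − 1 mod 2^(M+t)`; for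
`Δ_E < 0`, `ρ̄(τ)` itself is a transvection). [cite: RibetStein2001, Thm 3.19, Lemma 3.20] [cite: DDT1997, Thm 4.x (multiplicity one:
`ρ̄(Frob_q)` non-scalar for `q ∥ N`)] -/
def FrobTransvectionAt (W : WeierstrassCurve ℚ) [W.IsGloballyMinimal] (ℓ : ℕ) : Prop :=
  ∃! x : ZMod ℓ, (WeierstrassCurve.twoTorsionPolynomial
    ((WeierstrassCurve.integralModelInt W).map (Int.castRingHom (ZMod ℓ)))).toPoly.eval x = 0

/-! ## The five stubs -/

/-- **S1 · signed rank lowering at 2** (M/L; Chebotarev window primes at 2 + global duality at a Jetchev core vertex):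
on a corank-one frame, a sign `ε` and a bound `B` such that at every level `M` and slack `t` some Kolyvagin prime of
index `≥ M + t` has `#ORD_ε(M, ℓ) ≤ 2^B`. [cite: Jetchev2008, printed Prop. 5.3 p. 823 = arXiv Prop. 6.4 (core vertices exist; tree `prop53_exists_coreVertex_of_depth_add_le_levelIndex`), §5.2] [cite: MazurRubin2004, §4.1]
[cite: GrossParson2012, Lemma (parity)] [cite: LeHungLi2016, §7 (rank lowering at 2 over ℚ)] v1.3/v1.1: the prime is moreover a TRANSVECTION prime (`FrobTransvectionAt W ℓ`, forced by multiplicity one on the definite side, Ribet–Stein Lemma 3.20): Chebotarev in `K(E[2^(M+t)], 2^(-M)s)/ℚ` with the class of `τ·g`, `g ≡ (1 1; 0 1) (mod 2)`, `τg` of characteristic polynomial `X² − 1 (mod 2^(M+t))` — such `g` lie in the 2-adically surjective image (solve `a = d`, `c = (a² − 1)/b`, `b` odd); for `Δ_E < 0`, `ρ̄(τ)` is itself a transvection and `g ≡ 1`. (#616 P1, LOAD-BEARING FRAME HYPOTHESES for the transvection supply — do not weaken them without re-checking this stub): a transvection Kolyvagin prime of level ≥ 3 is a Frobenius σ with σ|_K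 ≠ 1, char. poly X² − 1 mod 2ⁿ, ODD on E[2]; χ_cyc(σ) ≡ −1 (mod 8) so σ fixes √2 and moves √−1, √−2, √−D: such primes exist (Chebotarev, K and ℚ(E[2ⁿ]) linearly disjoint) exactly because `∀ m, W.HasSurjectiveModNGaloisRep (2 ^ m)` forbids Δ_E ∈ {±1, ±2}·□ [cite: DokchitserDokchitser2012MathZ, Thm (2-adic surjective ⟺ mod 8 surjective)] and the Heegner hypothesis + `Odd (NumberField.discr K)` forbid Δ_E ∈ {D, 2D}·□; CLOSED FORM (critic #616 (1)): for an odd prime ℓ ∤ 2Δ_E, `FrobTransvectionAt W ℓ ⟺ (Δ_min/ℓ) = −1` (Frob_ℓ odd on E[2]); the strengthened window lemma exporting the Frobenius CLASS (not only `IsKolyvaginPrime`, cf. `…ChebotarevWindowPrimeAtTwo.exists_kolyvaginPrime_notMem_of_heegner`) is the prover-sized first step INSIDE this stub (#616 P2). -/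
theorem stub_signedRankLoweringAtTwo :
    ∀ (W : WeierstrassCurve ℚ) [W.IsElliptic] [W.IsGloballyMinimal], ¬ W.HasCM →
      (Literature.NumberTheory.EllipticCurves.Rank1Residual.GoodOrd W 2 ∨
        Literature.NumberTheory.EllipticCurves.Rank1Residual.Mult W 2) →
      (∀ m : ℕ, W.HasSurjectiveModNGaloisRep (2 ^ m : ℕ)) →
      ∀ (K : Type) [Field K] [NumberField K], Literature.NumberTheory.EllipticCurves.IsImaginaryQuadratic K →
      ∀ [NeZero (W.conductorNorm ℤ)],
      Literature.NumberTheory.EllipticCurves.SatisfiesHeegnerHypothesis (W.conductorNorm ℤ) K →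
      Odd (NumberField.discr K) → NumberField.discr K ≠ -3 →
      AddSubgroup.torsionBy (W.baseChange K).toAffine.Point (2 : ℤ) = ⊥ →
      Literature.NumberTheory.EllipticCurves.SatisfiesHeegnerHypothesis 2 K →
      ∀ (ι : K →+* ℂ) [∀ k : ℕ, NumberField (ringClassField K ι k)] (τ : K ≃ₐ[ℚ] K), τ ≠ 1 →
      (W.baseChange K).selmerCorank 2 = 1 →
      ∃ (B : ℕ) (ε : ℤ), (ε = 1 ∨ ε = -1) ∧ ∀ M t : ℕ, ∃ ℓ : ℕ,
        Literature.NumberTheory.EllipticCurves.Zhang2014.IsKolyvaginPrime (W.conductorNorm ℤ) W K 2 ℓ ∧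
        FrobTransvectionAt W ℓ ∧
        ((M + t : ℕ) : ℕ∞) ≤ Literature.NumberTheory.EllipticCurves.Zhang2014.levelIndex W 2 ℓ ∧
        Nat.card (signedOrdSel W K ι τ M ℓ ε) ≤ 2 ^ B := by
  sorry

/-- **ZB3 · signed level raising mod `2^M` at Kolyvagin primes** (L; beyond print for `M ≥ 2` — the print anchor
is `M = 1` with prescribed signs [LeHungLi2016, Thm 1]; multiplicity one mod `2^M` at a dihedral residual image is
the risk): for either sign a signed raised datum exists at every Kolyvagin prime of index `≥ M + t`.
Scope of the print anchor: [LeHungLi2016, Thm 1 = Thm 15] is literal only under their Assumption 7 (3) `N(ρ̄)` = odd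
part of `N` and (4) `ρ̄|_{G_{ℚ₂}} ≠ 1` (= `TwoTorsionNonsplitAtTwo`, now a HYPOTHESIS); off (3) even `M = 1` is beyond print.
[cite: LeHungLi2016, Thm 1 (= Thm 15, p. 6; proof §4 ordinary/multiplicative at 2 via Kisin 2009, §5 supersingular)] [cite: Kim2024, Thm 4.22]
[cite: Kilford2002, Thm 1] [cite: DiamondTaylor1994, Thm A (ℓ odd; the mod-2 substitute is LeHungLi2016 Thm 15)] v1.3: posed at TRANSVECTION Kolyvagin primes only (`FrobTransvectionAt W ℓ`; at scalar-Frobenius primes the definite module has multiplicity two at `𝔪` and the signed depth drops — instrument 53a1/ℓ=31). -/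
theorem stub_signedLevelRaisingAtTwo :
    ∀ (W : WeierstrassCurve ℚ) [W.IsElliptic] [W.IsGloballyMinimal], ¬ W.HasCM → TwoTorsionNonsplitAtTwo W →
      (Literature.NumberTheory.EllipticCurves.Rank1Residual.GoodOrd W 2 ∨
        Literature.NumberTheory.EllipticCurves.Rank1Residual.Mult W 2) →
      (∀ m : ℕ, W.HasSurjectiveModNGaloisRep (2 ^ m : ℕ)) →
      ∀ (K : Type) [Field K] [NumberField K], Literature.NumberTheory.EllipticCurves.IsImaginaryQuadratic K →
      ∀ [NeZero (W.conductorNorm ℤ)],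
      Literature.NumberTheory.EllipticCurves.SatisfiesHeegnerHypothesis (W.conductorNorm ℤ) K →
      Odd (NumberField.discr K) → NumberField.discr K ≠ -3 →
      ∃ t : ℕ, ∀ (M ℓ : ℕ) (ε : ℤ), (ε = 1 ∨ ε = -1) → 1 ≤ M →
        Literature.NumberTheory.EllipticCurves.Zhang2014.IsKolyvaginPrime (W.conductorNorm ℤ) W K 2 ℓ →
        FrobTransvectionAt W ℓ →
        ((M + t : ℕ) : ℕ∞) ≤ Literature.NumberTheory.EllipticCurves.Zhang2014.levelIndex W 2 ℓ →
        ∃ (a b : ℚ) (O : Subring (QuaternionAlgebra ℚ a 0 b))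
          (φ : Submodule ℤ (QuaternionAlgebra ℚ a 0 b) → ZMod (2 ^ M)) (ψ : K →ₐ[ℚ] QuaternionAlgebra ℚ a 0 b)
          (I : Submodule ℤ (QuaternionAlgebra ℚ a 0 b))
          (rep : ClassGroup (NumberField.RingOfIntegers K) → nonZeroDivisors (Ideal (NumberField.RingOfIntegers K))),
          IsSignedDatum W K M ℓ ε a b O φ ψ I rep := by
  sorry

/-- **ZB1′ · signed definite rigidity at 2 — THE WALL** (XL; a rank-zero lower bound at 2 for the sign-`ε` raised
form: Skinner–Urban's role in [WZhang2014, Thm 1.1]; shape = Howard 2006 Thm 3.2.3 / Kim 2024 Thm 4.19 at `p ≥ 5`):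
universal constants `σ ∈ {±1}` (the `U_ℓ = −W_ℓ` convention), `C`, `t` such that `#ORD_{σε}(M, ℓ) ≤ 2^B` forces the
toric period of every sign-`ε` datum at `(M, ℓ)` to have additive order `≥ 2^(M − C − B)`.
[cite: WZhang2014, Thm 1.1 with §7 (rank lowering ⇒ unit L-value via SU)] [cite: Howard2006, Thm 3.2.3] [cite: Kim2024, Thm 4.19, Thm 4.26]
[cite: SkinnerUrban2014, Thm 3.29 (no analogue at p = 2)] -/
theorem stub_signedDefiniteRigidityAtTwo :
    ∃ (σ : ℤ), (σ = 1 ∨ σ = -1) ∧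
    ∀ (W : WeierstrassCurve ℚ) [W.IsElliptic] [W.IsGloballyMinimal], ¬ W.HasCM → TwoTorsionNonsplitAtTwo W →
      (Literature.NumberTheory.EllipticCurves.Rank1Residual.GoodOrd W 2 ∨
        Literature.NumberTheory.EllipticCurves.Rank1Residual.Mult W 2) →
      (∀ m : ℕ, W.HasSurjectiveModNGaloisRep (2 ^ m : ℕ)) →
      ∀ (K : Type) [Field K] [NumberField K], Literature.NumberTheory.EllipticCurves.IsImaginaryQuadratic K →
      ∀ [NeZero (W.conductorNorm ℤ)],
      Literature.NumberTheory.EllipticCurves.SatisfiesHeegnerHypothesis (W.conductorNorm ℤ) K →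
      Odd (NumberField.discr K) → NumberField.discr K ≠ -3 →
      AddSubgroup.torsionBy (W.baseChange K).toAffine.Point (2 : ℤ) = ⊥ →
      Literature.NumberTheory.EllipticCurves.SatisfiesHeegnerHypothesis 2 K →
      ∀ (ι : K →+* ℂ) [∀ k : ℕ, NumberField (ringClassField K ι k)] (τ : K ≃ₐ[ℚ] K), τ ≠ 1 →
      ∃ C t : ℕ, ∀ (M ℓ : ℕ) (ε : ℤ), (ε = 1 ∨ ε = -1) →
        Literature.NumberTheory.EllipticCurves.Zhang2014.IsKolyvaginPrime (W.conductorNorm ℤ) W K 2 ℓ →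
        FrobTransvectionAt W ℓ →
        ((M + t : ℕ) : ℕ∞) ≤ Literature.NumberTheory.EllipticCurves.Zhang2014.levelIndex W 2 ℓ →
        ∀ (a b : ℚ) (O : Subring (QuaternionAlgebra ℚ a 0 b))
          (φ : Submodule ℤ (QuaternionAlgebra ℚ a 0 b) → ZMod (2 ^ M)) (ψ : K →ₐ[ℚ] QuaternionAlgebra ℚ a 0 b)
          (I : Submodule ℤ (QuaternionAlgebra ℚ a 0 b))
          (rep : ClassGroup (NumberField.RingOfIntegers K) → nonZeroDivisors (Ideal (NumberField.RingOfIntegers K))),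
          IsSignedDatum W K M ℓ ε a b O φ ψ I rep →
        ∀ B : ℕ, Nat.card (signedOrdSel W K ι τ M ℓ (σ * ε)) ≤ 2 ^ B →
          2 ^ M ≤ 2 ^ (C + B) * addOrderOf (toricPeriod φ ψ I rep) := by
  sorry

/-- **ZB2 · signed reciprocity law at 2 («class at depth 0 ↦ period at depth 1»), exponent form** (L; print-port at 2 of
`loc_λ c(1) ↔ λ(ℓ)`: this is the JOCHNOWITZ congruence = [WZhang2014, Thm 4.3, the `loc_{q₁}` part, and Thm 6.5; Remark 12]
= Bertolini–Darmon's SECOND explicit reciprocity law [BertoliniDarmon2005, Thm 4.2] (their first law, Thm 4.1, is the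
other direction «period ↦ class at one more prime», not used here), [Vatsal2003]; the `2`-part of
the Manin constant, of `#E(𝔽_{λ})` and of the component groups are the bounded defect `C`): the toric period of any
signed datum has additive order at most `2^C` times that of Kolyvagin's class `c_M(1)` of `P(1) = y_K`.
[cite: WZhang2014, Thm 4.3 (loc_{q₁}: Jochnowitz congruence), Thm 6.5, Remark 12] [cite: BertoliniDarmon2005, Thm 4.2 (second explicit reciprocity law)]
[cite: GrossLMS1991, §4 (4.4)] [cite: WZhang2014, Thm 6.4 (Ribet–Takahashi/Khare/Pollack–Weston comparison of periods)] -/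
theorem stub_signedFirstReciprocityAtTwo :
    ∀ (W : WeierstrassCurve ℚ) [W.IsElliptic] [W.IsGloballyMinimal], ¬ W.HasCM → TwoTorsionNonsplitAtTwo W →
      (Literature.NumberTheory.EllipticCurves.Rank1Residual.GoodOrd W 2 ∨
        Literature.NumberTheory.EllipticCurves.Rank1Residual.Mult W 2) →
      (∀ m : ℕ, W.HasSurjectiveModNGaloisRep (2 ^ m : ℕ)) →
      ∀ (K : Type) [Field K] [NumberField K], Literature.NumberTheory.EllipticCurves.IsImaginaryQuadratic K →
      ∀ [NeZero (W.conductorNorm ℤ)],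
      Literature.NumberTheory.EllipticCurves.SatisfiesHeegnerHypothesis (W.conductorNorm ℤ) K →
      Odd (NumberField.discr K) → NumberField.discr K ≠ -3 →
      AddSubgroup.torsionBy (W.baseChange K).toAffine.Point (2 : ℤ) = ⊥ →
      Literature.NumberTheory.EllipticCurves.SatisfiesHeegnerHypothesis 2 K →
      ∀ (Dt : Literature.NumberTheory.EllipticCurves.ModularForms.ModularParametrizationData W (W.conductorNorm ℤ))
        (β : ℤ) (ι : K →+* ℂ), (4 * (W.conductorNorm ℤ : ℤ)) ∣ β ^ 2 - NumberField.discr K →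
      ∀ (d₁ : Literature.NumberTheory.EllipticCurves.KolyvaginHeegnerData Dt β ι 1),
      ∃ C t : ℕ, ∀ (M ℓ : ℕ) (ε : ℤ), (ε = 1 ∨ ε = -1) →
        Literature.NumberTheory.EllipticCurves.Zhang2014.IsKolyvaginPrime (W.conductorNorm ℤ) W K 2 ℓ →
        FrobTransvectionAt W ℓ →
        ((M + t : ℕ) : ℕ∞) ≤ Literature.NumberTheory.EllipticCurves.Zhang2014.levelIndex W 2 ℓ →
        ∀ (a b : ℚ) (O : Subring (QuaternionAlgebra ℚ a 0 b))
          (φ : Submodule ℤ (QuaternionAlgebra ℚ a 0 b) → ZMod (2 ^ M)) (ψ : K →ₐ[ℚ] QuaternionAlgebra ℚ a 0 b)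
          (I : Submodule ℤ (QuaternionAlgebra ℚ a 0 b))
          (rep : ClassGroup (NumberField.RingOfIntegers K) → nonZeroDivisors (Ideal (NumberField.RingOfIntegers K))),
          IsSignedDatum W K M ℓ ε a b O φ ψ I rep →
          addOrderOf (toricPeriod φ ψ I rep) ≤ 2 ^ C * addOrderOf (d₁.kolyvaginClass Nat.prime_two M) := by
  sorry

/-- **S3 · the off-corank-one residual** (XL, honest): U1's body on the frames whose `2^∞`-Selmer corank over `K`
is not `1` (Kolyvagin's conjecture at 2 in higher rank; corank `0` is excluded by `2`-parity under the Heegner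
hypothesis). [cite: Kolyvagin1991MathAnn, §2 Conj. A] [cite: WZhang2014, Thm 1.1 (p ≥ 5)] -/
theorem stub_offCorankOneResidualAtTwo :
    ∀ (W : WeierstrassCurve ℚ) [W.IsElliptic] [W.IsGloballyMinimal], ¬ W.HasCM →
      (Literature.NumberTheory.EllipticCurves.Rank1Residual.GoodOrd W 2 ∨
        Literature.NumberTheory.EllipticCurves.Rank1Residual.Mult W 2) →
      (∀ m : ℕ, W.HasSurjectiveModNGaloisRep (2 ^ m : ℕ)) →
      ∀ (K : Type) [Field K] [NumberField K], Literature.NumberTheory.EllipticCurves.IsImaginaryQuadratic K →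
      ∀ [NeZero (W.conductorNorm ℤ)],
      Literature.NumberTheory.EllipticCurves.SatisfiesHeegnerHypothesis (W.conductorNorm ℤ) K →
      Odd (NumberField.discr K) → NumberField.discr K ≠ -3 →
      AddSubgroup.torsionBy (W.baseChange K).toAffine.Point (2 : ℤ) = ⊥ →
      Literature.NumberTheory.EllipticCurves.SatisfiesHeegnerHypothesis 2 K →
      ∀ (Dt : Literature.NumberTheory.EllipticCurves.ModularForms.ModularParametrizationData W (W.conductorNorm ℤ))
        (β : ℤ) (ι : K →+* ℂ), (4 * (W.conductorNorm ℤ : ℤ)) ∣ β ^ 2 - NumberField.discr K →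
      ((W.baseChange K).selmerCorank 2 ≠ 1 ∨ ¬ TwoTorsionNonsplitAtTwo W) →
      ∃ r m : ℕ, ∀ M : ℕ, m < M →
        ∃ (n : ℕ) (d : Literature.NumberTheory.EllipticCurves.KolyvaginHeegnerData Dt β ι n),
          Literature.NumberTheory.EllipticCurves.KolyvaginDescent.KolSupp
            (Literature.NumberTheory.EllipticCurves.Zhang2014.IsKolyvaginPrime (W.conductorNorm ℤ) W K 2) n ∧
          n.primeFactors.card = r ∧
          ((M : ℕ) : ℕ∞) ≤ Literature.NumberTheory.EllipticCurves.Zhang2014.levelIndex W 2 n ∧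
          (2 ^ (M - m - 1) : ℤ) • d.kolyvaginClass Nat.prime_two M ≠ 0 := by
  sorry

/-! ## The composition (kernel-checked; no sorry below this line) -/

/-- Arithmetic of the exponent currency: if `x` has additive order with `2^M ≤ 2^m · addOrderOf x` and `m < M`,
then `2^(M-m-1) • x ≠ 0`. [folklore] -/
theorem pow_zsmul_ne_zero_of_le_mul_addOrderOf {A : Type*} [AddCommGroup A] (x : A) {M m : ℕ} (hm : m < M)
    (h : 2 ^ M ≤ 2 ^ m * addOrderOf x) : (2 ^ (M - m - 1) : ℤ) • x ≠ 0 := by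
  intro h0
  have h0' : (2 ^ (M - m - 1)) • x = 0 := by
    rw [← natCast_zsmul]; push_cast; exact h0
  have hdvd : addOrderOf x ∣ 2 ^ (M - m - 1) := addOrderOf_dvd_of_nsmul_eq_zero h0'
  have hle : addOrderOf x ≤ 2 ^ (M - m - 1) := Nat.le_of_dvd (by positivity) hdvd
  have h1 : 2 ^ M ≤ 2 ^ m * 2 ^ (M - m - 1) := le_trans h (Nat.mul_le_mul_left _ hle)
  rw [← pow_add] at h1
  have h2 := (Nat.pow_le_pow_iff_right (by norm_num : 1 < 2)).mp h1
  omega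

/-- **LINE 39: S1 → ZB3 → ZB1′ → ZB2 → S3 → U1** (`KolyvaginBoundedDefectAtTwo`, concluded BY NAME).
On a corank-one frame the signed bipartite chain at depth `r = 0`, conductor `n = 1`; off corank one the residual. -/
theorem KolyvaginBoundedDefectAtTwo_of
    (hS1 : ∀ (W : WeierstrassCurve ℚ) [W.IsElliptic] [W.IsGloballyMinimal], ¬ W.HasCM →
      (Literature.NumberTheory.EllipticCurves.Rank1Residual.GoodOrd W 2 ∨
        Literature.NumberTheory.EllipticCurves.Rank1Residual.Mult W 2) →
      (∀ m : ℕ, W.HasSurjectiveModNGaloisRep (2 ^ m : ℕ)) →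
      ∀ (K : Type) [Field K] [NumberField K], Literature.NumberTheory.EllipticCurves.IsImaginaryQuadratic K →
      ∀ [NeZero (W.conductorNorm ℤ)],
      Literature.NumberTheory.EllipticCurves.SatisfiesHeegnerHypothesis (W.conductorNorm ℤ) K →
      Odd (NumberField.discr K) → NumberField.discr K ≠ -3 →
      AddSubgroup.torsionBy (W.baseChange K).toAffine.Point (2 : ℤ) = ⊥ →
      Literature.NumberTheory.EllipticCurves.SatisfiesHeegnerHypothesis 2 K →
      ∀ (ι : K →+* ℂ) [∀ k : ℕ, NumberField (ringClassField K ι k)] (τ : K ≃ₐ[ℚ] K), τ ≠ 1 →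
      (W.baseChange K).selmerCorank 2 = 1 →
      ∃ (B : ℕ) (ε : ℤ), (ε = 1 ∨ ε = -1) ∧ ∀ M t : ℕ, ∃ ℓ : ℕ,
        Literature.NumberTheory.EllipticCurves.Zhang2014.IsKolyvaginPrime (W.conductorNorm ℤ) W K 2 ℓ ∧
        FrobTransvectionAt W ℓ ∧
        ((M + t : ℕ) : ℕ∞) ≤ Literature.NumberTheory.EllipticCurves.Zhang2014.levelIndex W 2 ℓ ∧
        Nat.card (signedOrdSel W K ι τ M ℓ ε) ≤ 2 ^ B)
    (hZB3 : ∀ (W : WeierstrassCurve ℚ) [W.IsElliptic] [W.IsGloballyMinimal], ¬ W.HasCM → TwoTorsionNonsplitAtTwo W →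
      (Literature.NumberTheory.EllipticCurves.Rank1Residual.GoodOrd W 2 ∨
        Literature.NumberTheory.EllipticCurves.Rank1Residual.Mult W 2) →
      (∀ m : ℕ, W.HasSurjectiveModNGaloisRep (2 ^ m : ℕ)) →
      ∀ (K : Type) [Field K] [NumberField K], Literature.NumberTheory.EllipticCurves.IsImaginaryQuadratic K →
      ∀ [NeZero (W.conductorNorm ℤ)],
      Literature.NumberTheory.EllipticCurves.SatisfiesHeegnerHypothesis (W.conductorNorm ℤ) K →
      Odd (NumberField.discr K) → NumberField.discr K ≠ -3 →
      ∃ t : ℕ, ∀ (M ℓ : ℕ) (ε : ℤ), (ε = 1 ∨ ε = -1) → 1 ≤ M →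
        Literature.NumberTheory.EllipticCurves.Zhang2014.IsKolyvaginPrime (W.conductorNorm ℤ) W K 2 ℓ →
        FrobTransvectionAt W ℓ →
        ((M + t : ℕ) : ℕ∞) ≤ Literature.NumberTheory.EllipticCurves.Zhang2014.levelIndex W 2 ℓ →
        ∃ (a b : ℚ) (O : Subring (QuaternionAlgebra ℚ a 0 b))
          (φ : Submodule ℤ (QuaternionAlgebra ℚ a 0 b) → ZMod (2 ^ M)) (ψ : K →ₐ[ℚ] QuaternionAlgebra ℚ a 0 b)
          (I : Submodule ℤ (QuaternionAlgebra ℚ a 0 b))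
          (rep : ClassGroup (NumberField.RingOfIntegers K) → nonZeroDivisors (Ideal (NumberField.RingOfIntegers K))),
          IsSignedDatum W K M ℓ ε a b O φ ψ I rep)
    (hZB1 : ∃ (σ : ℤ), (σ = 1 ∨ σ = -1) ∧
    ∀ (W : WeierstrassCurve ℚ) [W.IsElliptic] [W.IsGloballyMinimal], ¬ W.HasCM → TwoTorsionNonsplitAtTwo W →
      (Literature.NumberTheory.EllipticCurves.Rank1Residual.GoodOrd W 2 ∨
        Literature.NumberTheory.EllipticCurves.Rank1Residual.Mult W 2) →
      (∀ m : ℕ, W.HasSurjectiveModNGaloisRep (2 ^ m : ℕ)) →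
      ∀ (K : Type) [Field K] [NumberField K], Literature.NumberTheory.EllipticCurves.IsImaginaryQuadratic K →
      ∀ [NeZero (W.conductorNorm ℤ)],
      Literature.NumberTheory.EllipticCurves.SatisfiesHeegnerHypothesis (W.conductorNorm ℤ) K →
      Odd (NumberField.discr K) → NumberField.discr K ≠ -3 →
      AddSubgroup.torsionBy (W.baseChange K).toAffine.Point (2 : ℤ) = ⊥ →
      Literature.NumberTheory.EllipticCurves.SatisfiesHeegnerHypothesis 2 K →
      ∀ (ι : K →+* ℂ) [∀ k : ℕ, NumberField (ringClassField K ι k)] (τ : K ≃ₐ[ℚ] K), τ ≠ 1 →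
      ∃ C t : ℕ, ∀ (M ℓ : ℕ) (ε : ℤ), (ε = 1 ∨ ε = -1) →
        Literature.NumberTheory.EllipticCurves.Zhang2014.IsKolyvaginPrime (W.conductorNorm ℤ) W K 2 ℓ →
        FrobTransvectionAt W ℓ →
        ((M + t : ℕ) : ℕ∞) ≤ Literature.NumberTheory.EllipticCurves.Zhang2014.levelIndex W 2 ℓ →
        ∀ (a b : ℚ) (O : Subring (QuaternionAlgebra ℚ a 0 b))
          (φ : Submodule ℤ (QuaternionAlgebra ℚ a 0 b) → ZMod (2 ^ M)) (ψ : K →ₐ[ℚ] QuaternionAlgebra ℚ a 0 b)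
          (I : Submodule ℤ (QuaternionAlgebra ℚ a 0 b))
          (rep : ClassGroup (NumberField.RingOfIntegers K) → nonZeroDivisors (Ideal (NumberField.RingOfIntegers K))),
          IsSignedDatum W K M ℓ ε a b O φ ψ I rep →
        ∀ B : ℕ, Nat.card (signedOrdSel W K ι τ M ℓ (σ * ε)) ≤ 2 ^ B →
          2 ^ M ≤ 2 ^ (C + B) * addOrderOf (toricPeriod φ ψ I rep))
    (hZB2 : ∀ (W : WeierstrassCurve ℚ) [W.IsElliptic] [W.IsGloballyMinimal], ¬ W.HasCM → TwoTorsionNonsplitAtTwo W →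
      (Literature.NumberTheory.EllipticCurves.Rank1Residual.GoodOrd W 2 ∨
        Literature.NumberTheory.EllipticCurves.Rank1Residual.Mult W 2) →
      (∀ m : ℕ, W.HasSurjectiveModNGaloisRep (2 ^ m : ℕ)) →
      ∀ (K : Type) [Field K] [NumberField K], Literature.NumberTheory.EllipticCurves.IsImaginaryQuadratic K →
      ∀ [NeZero (W.conductorNorm ℤ)],
      Literature.NumberTheory.EllipticCurves.SatisfiesHeegnerHypothesis (W.conductorNorm ℤ) K →
      Odd (NumberField.discr K) → NumberField.discr K ≠ -3 →
      AddSubgroup.torsionBy (W.baseChange K).toAffine.Point (2 : ℤ) = ⊥ →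
      Literature.NumberTheory.EllipticCurves.SatisfiesHeegnerHypothesis 2 K →
      ∀ (Dt : Literature.NumberTheory.EllipticCurves.ModularForms.ModularParametrizationData W (W.conductorNorm ℤ))
        (β : ℤ) (ι : K →+* ℂ), (4 * (W.conductorNorm ℤ : ℤ)) ∣ β ^ 2 - NumberField.discr K →
      ∀ (d₁ : Literature.NumberTheory.EllipticCurves.KolyvaginHeegnerData Dt β ι 1),
      ∃ C t : ℕ, ∀ (M ℓ : ℕ) (ε : ℤ), (ε = 1 ∨ ε = -1) →
        Literature.NumberTheory.EllipticCurves.Zhang2014.IsKolyvaginPrime (W.conductorNorm ℤ) W K 2 ℓ →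
        FrobTransvectionAt W ℓ →
        ((M + t : ℕ) : ℕ∞) ≤ Literature.NumberTheory.EllipticCurves.Zhang2014.levelIndex W 2 ℓ →
        ∀ (a b : ℚ) (O : Subring (QuaternionAlgebra ℚ a 0 b))
          (φ : Submodule ℤ (QuaternionAlgebra ℚ a 0 b) → ZMod (2 ^ M)) (ψ : K →ₐ[ℚ] QuaternionAlgebra ℚ a 0 b)
          (I : Submodule ℤ (QuaternionAlgebra ℚ a 0 b))
          (rep : ClassGroup (NumberField.RingOfIntegers K) → nonZeroDivisors (Ideal (NumberField.RingOfIntegers K))),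
          IsSignedDatum W K M ℓ ε a b O φ ψ I rep →
          addOrderOf (toricPeriod φ ψ I rep) ≤ 2 ^ C * addOrderOf (d₁.kolyvaginClass Nat.prime_two M))
    (hS3 : ∀ (W : WeierstrassCurve ℚ) [W.IsElliptic] [W.IsGloballyMinimal], ¬ W.HasCM →
      (Literature.NumberTheory.EllipticCurves.Rank1Residual.GoodOrd W 2 ∨
        Literature.NumberTheory.EllipticCurves.Rank1Residual.Mult W 2) →
      (∀ m : ℕ, W.HasSurjectiveModNGaloisRep (2 ^ m : ℕ)) →
      ∀ (K : Type) [Field K] [NumberField K], Literature.NumberTheory.EllipticCurves.IsImaginaryQuadratic K →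
      ∀ [NeZero (W.conductorNorm ℤ)],
      Literature.NumberTheory.EllipticCurves.SatisfiesHeegnerHypothesis (W.conductorNorm ℤ) K →
      Odd (NumberField.discr K) → NumberField.discr K ≠ -3 →
      AddSubgroup.torsionBy (W.baseChange K).toAffine.Point (2 : ℤ) = ⊥ →
      Literature.NumberTheory.EllipticCurves.SatisfiesHeegnerHypothesis 2 K →
      ∀ (Dt : Literature.NumberTheory.EllipticCurves.ModularForms.ModularParametrizationData W (W.conductorNorm ℤ))
        (β : ℤ) (ι : K →+* ℂ), (4 * (W.conductorNorm ℤ : ℤ)) ∣ β ^ 2 - NumberField.discr K →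
      ((W.baseChange K).selmerCorank 2 ≠ 1 ∨ ¬ TwoTorsionNonsplitAtTwo W) →
      ∃ r m : ℕ, ∀ M : ℕ, m < M →
        ∃ (n : ℕ) (d : Literature.NumberTheory.EllipticCurves.KolyvaginHeegnerData Dt β ι n),
          Literature.NumberTheory.EllipticCurves.KolyvaginDescent.KolSupp
            (Literature.NumberTheory.EllipticCurves.Zhang2014.IsKolyvaginPrime (W.conductorNorm ℤ) W K 2) n ∧
          n.primeFactors.card = r ∧
          ((M : ℕ) : ℕ∞) ≤ Literature.NumberTheory.EllipticCurves.Zhang2014.levelIndex W 2 n ∧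
          (2 ^ (M - m - 1) : ℤ) • d.kolyvaginClass Nat.prime_two M ≠ 0) :
    KolyvaginBoundedDefectAtTwo := by
  intro W _ _ hCM hred hsurj K _ _ hK _ hH hodd hd3 htors hH2 Dt β ι hβ
  by_cases h2t : TwoTorsionNonsplitAtTwo W
  swap
  · exact hS3 W hCM hred hsurj K hK hH hodd hd3 htors hH2 Dt β ι hβ (Or.inr h2t)
  by_cases hco : (W.baseChange K).selmerCorank 2 = 1
  swap
  · exact hS3 W hCM hred hsurj K hK hH hodd hd3 htors hH2 Dt β ι hβ (Or.inl hco)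
  -- corank one: the signed bipartite chain at depth zero
  haveI : ∀ k : ℕ, NumberField (ringClassField K ι k) :=
    Summit.BirchSwinnertonDyer.Rank1Residual.JET.numberField_ringClassField K hK ι
  obtain ⟨τ, hτ1⟩ := Summit.BirchSwinnertonDyer.Rank1Residual.JET.exists_algEquiv_ne_one_of_isImaginaryQuadratic K hK
  -- a Heegner datum of conductor 1 exists on the frame (tree: the depth-zero habitat)
  obtain ⟨d₁⟩ : Nonempty (Literature.NumberTheory.EllipticCurves.KolyvaginHeegnerData Dt β ι 1) :=
    Summit.BirchSwinnertonDyer.BirchSwinnertonDyer.Theorems.nonempty_kolyvaginHeegnerData_of_grossCM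
      (phi_heegnerPointOfConductor_mem_range_map_ringClassField_holds (W.conductorNorm ℤ) W K)
      exists_generator_ringClassGalOver_holds hK hH Dt β ι hβ squarefree_one (by simp)
  obtain ⟨B, ε, hε, hsup⟩ := hS1 W hCM hred hsurj K hK hH hodd hd3 htors hH2 ι τ hτ1 hco
  obtain ⟨t₃, hraise⟩ := hZB3 W hCM h2t hred hsurj K hK hH hodd hd3
  obtain ⟨σ, hσ, hZB1'⟩ := hZB1
  obtain ⟨C₁, t₁, hrig⟩ := hZB1' W hCM h2t hred hsurj K hK hH hodd hd3 htors hH2 ι τ hτ1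
  obtain ⟨C₂, t₂, hrec⟩ := hZB2 W hCM h2t hred hsurj K hK hH hodd hd3 htors hH2 Dt β ι hβ d₁
  refine ⟨0, C₁ + B + C₂, fun M hM ↦ ⟨1, d₁, KolyvaginDescent.kolSupp_one _, by simp, by simp [Zhang2014.levelIndex_one], ?_⟩⟩
  -- the prime, the datum of sign σ·ε, the period bound, the reciprocity bound
  obtain ⟨ℓ, hKol, hT, hidx, hcard⟩ := hsup M (t₁ + t₂ + t₃)
  have hσε : σ * ε = 1 ∨ σ * ε = -1 := by
    rcases hσ with rfl | rfl <;> rcases hε with rfl | rfl <;> simp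
  have hσσε : σ * (σ * ε) = ε := by
    rcases hσ with rfl | rfl <;> simp
  have hidx₃ : ((M + t₃ : ℕ) : ℕ∞) ≤ Literature.NumberTheory.EllipticCurves.Zhang2014.levelIndex W 2 ℓ :=
    le_trans (by exact_mod_cast (show M + t₃ ≤ M + (t₁ + t₂ + t₃) by omega)) hidx
  have hidx₁ : ((M + t₁ : ℕ) : ℕ∞) ≤ Literature.NumberTheory.EllipticCurves.Zhang2014.levelIndex W 2 ℓ :=
    le_trans (by exact_mod_cast (show M + t₁ ≤ M + (t₁ + t₂ + t₃) by omega)) hidx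
  have hidx₂ : ((M + t₂ : ℕ) : ℕ∞) ≤ Literature.NumberTheory.EllipticCurves.Zhang2014.levelIndex W 2 ℓ :=
    le_trans (by exact_mod_cast (show M + t₂ ≤ M + (t₁ + t₂ + t₃) by omega)) hidx
  have hM1 : 1 ≤ M := by omega
  obtain ⟨a, b, O, φ, ψ, I, rep, hdat⟩ := hraise M ℓ (σ * ε) hσε hM1 hKol hT hidx₃
  have hper : 2 ^ M ≤ 2 ^ (C₁ + B) * addOrderOf (toricPeriod φ ψ I rep) := by
    have := hrig M ℓ (σ * ε) hσε hKol hT hidx₁ a b O φ ψ I rep hdat B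
    rw [hσσε] at this
    exact this hcard
  have hrc := hrec M ℓ (σ * ε) hσε hKol hT hidx₂ a b O φ ψ I rep hdat
  apply pow_zsmul_ne_zero_of_le_mul_addOrderOf _ hM
  calc 2 ^ M ≤ 2 ^ (C₁ + B) * addOrderOf (toricPeriod φ ψ I rep) := hper
    _ ≤ 2 ^ (C₁ + B) * (2 ^ C₂ * addOrderOf (d₁.kolyvaginClass Nat.prime_two M)) := Nat.mul_le_mul_left _ hrc
    _ = 2 ^ (C₁ + B + C₂) * addOrderOf (d₁.kolyvaginClass Nat.prime_two M) := by rw [pow_add 2 (C₁ + B) C₂]; ring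

/-- The line concludes the crux BY NAME from its five stubs. -/
theorem KolyvaginBoundedDefectAtTwo_of_stubs : KolyvaginBoundedDefectAtTwo :=
  KolyvaginBoundedDefectAtTwo_of stub_signedRankLoweringAtTwo stub_signedLevelRaisingAtTwo
    stub_signedDefiniteRigidityAtTwo stub_signedFirstReciprocityAtTwo stub_offCorankOneResidualAtTwo

end Summit.BirchSwinnertonDyer.BirchSwinnertonDyer.Cruxes.KolyvaginBoundedDefectAtTwo.SignedBipartite

end
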